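import Summits.QuantumFields.BalabanUV.Beta.D1BFx.GhostWordFamilies
import Summits.QuantumFields.BalabanUV.Beta.D1BFx.GhostWordLegLetters
import Summits.QuantumFields.BalabanUV.Beta.D1BFx.GhostWordJetLetters
import Summits.QuantumFields.BalabanUV.Beta.D1BFx.RestKernelGhostWords

/-!
# `BalabanUV.Beta.D1BFx.RestKernelGhostUnit` — road «BF-x» for binder row D1, slot (K), DICT-CHAIN-SPEC §2 (II) row RK-GH, «RK-GH-UNIT» FILE 4:
# **THE n-UNIFORM (1.22)-MOMENT ROWS OF THE TWELVE GHOST REST WORDS AT THE `ℋ`-PACKED JETS — EVERY WORD IS VANISHING CLASS**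
# `|secondMoment (ghostWordK (Ggh n a) (Pgt n a) 𝒱 𝒲 i) μ ν| ≤ K_i(a)·n^{−e_i}·M(rate)`, `e_i ≥ 2`, for every `n = m + 1`, `i : GhIdx`, `μ ν`

HONEST DEPENDENCY (cell records, verbatim): «continuum YM on T⁴ ⇐ BetaPertH ∧ nine spine estimates (0/9 proved); BetaPertH ⇐ (D1) ∧ (D4) ∧
CAP+tail; G-an2-4 gates asym, D1 and NE2/3/4.»  HONEST FRAMING (cell contract, verbatim): «discharging `BetaPertH` makes Bałaban's UV stability
UNCONDITIONAL — a real constructive-QFT result; it is NOT the continuum limit and NOT the Clay problem.»  THIS MODULE DISCHARGES NOTHING of the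
wall: [folklore] assembly BY NAME of FILE 1b (`GhostWordFamilies.decay510_tadpoleWord_of_mass` ∕ `decay510_biBubbleWord_of_decays_bdd_mass` ∕ `…_of_bdd_decays_mass`),
FILE 2 (`GhostWordLegLetters`: `bdd_Pgt_sup`, `decays_Ggh_PP`, `decays_Pgt_sup`, `bdd_comp_*`, `decays_comp_*`), FILE 3b (`GhostWordJetLetters.mass_vertexRedF_ghCur_le`,
`mass_tableRedF_gh11_le'`), leaf-01's `RestKernelGhostWords.ghostWordK` (a `rfl` unfolding per index) and `B12Sec2to5.secondMoment_abs_le_of_decay510`.  UNCONDITIONAL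
(`0 < a` only): no `h12`∕`h126`, no printed statement, no `def`, no `def … : Prop`, nothing cited, 0 sorry.  IT IS the RK-GH unit row `hRu`∕`hU` of
`RoadEndBFxDictPointwiseS.hdict_of_pointwise` for the twelve ghost members (`Ru := secondMoment`, `CU′ := 0`, `CU` below); their `hMR` is the OWNER's K5 of
[D1P2-G16-X34] (`absMoment₂_ghostWordK_road_rescaled`, cited, not re-derived).  0 root-level binders of row D1 discharged (hW ∕ hR-sockets ∕ hSX-socket ∕ D1Tel ∕
D1Rep — 0); (K) NOT closed (the other RK rows, (S-LIT), (S-N), A1-PACKED remain); NOT D1, NOT `BetaPertH`, NOT continuum, NOT Clay.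

ABSOLUTE RULE (cell charter, verbatim): «No internally-minted statement may enter as a cited fact. Every hypothesis is either kernel-proved in
this package or a verbatim quotation of a PUBLISHED theorem with page reference. The manuscript(s) under audit are NOT citable for their own
disputed steps — they are the thing under adjudication; programme-internal (2001/route/tribunal) claims are never citable.»

THE COUNT, PER WORD (F-d1leaf04-g18-1, journal [D1LEAF04-G18-ONLINE]; OWNER W-d1p2-g16-5 (B) «display the power»).  `n = m+1`; `SP := cPPs∕n⁴` (the
projector's sharp sup), `SG := 2∕min 2 a`, `MG := cNear·K₄(ghDelta)` (the ghost leg's fine ℓ¹ mass), `KPG := cPPs·e^{δ_PP}·SG·(1 + 16∕δ_PP)⁴` (the composite's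
n-free decay constant), `mV := CV·n` (first jet), `mW := CW·n⁻⁴` (table), rate `σ₀ := min (δ_PP∕8) (κ′∕16)` (bubbles) ∕ `κ′∕8` (tadpoles):
| `i : GhIdx`                     | word                          | decay leg ∕ sup leg             | `Decay510` constant                    | power  |
| `inl b`                          | `½·tadpole (G∘P ∣ P∘G) W`       | — ∕ `SP·MG`                      | `½·(SP·MG)·mW`                         | `n⁻⁸`  |
| `inr (inl (none, s))`            | `−½·biBubble` over `(G∘G, P)`   | `P` (`SP·e^{δ_PP}`) ∕ `SG·MG`     | `½·(SG·MG)·(SP·e^{δ_PP})·mV²`           | `n⁻²`  |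
| `inr (inl (some false, s))`      | over `(G, P∘G)`                | `G` (`SG`) ∕ `SP·MG`              | `½·SG·(SP·MG)·mV²`                     | `n⁻²`  |
| `inr (inl (some true, s))`       | over `(G, G∘P)`                | `G` ∕ `MG·SP`                     | `½·SG·(MG·SP)·mV²`                     | `n⁻²`  |
| `inr (inr (inl b))`              | `½·biBubble` over `(G∘P, G∘P)` ∣ `(P∘G, P∘G)` | composite (`KPG`) ∕ `SP·MG` | `½·KPG·(SP·MG)·mV²`                    | `n⁻²`  |
| `inr (inr (inr b))`              | over `(P, G∘P∘G)`              | `P` (`SP·e^{δ_PP}`) ∕ `MG·(SP·MG)` | `½·(SP·e^{δ_PP})·(MG·(SP·MG))·mV²`      | `n⁻⁶`  |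
The (1.22) moment is `≤ constant × Σ'_x |x|₁²e^{−rate·|x|₁}` (`secondMoment_abs_le_of_decay510`), rate n-free ⇒ **unit class with at least `n²` to spare**.
HERE: the twelve `Decay510` letters with the displayed constants (§2) and the (1.22) shape (§1 `abs_secondMoment_le`: each word's moment is
`≤ constant × M(rate)` at once).  NOT HERE (honest): the single uniform constant `KU(a)·n⁻²` over `GhIdx` (companion FILE 4b `RestKernelGhostUnitRow`, the
400-line rule), ΔGH's row (FILE 5 «ΔGH-UNIT», ρ-g16-2), the `Rk` wiring (leaf-01's rest-word lane), Q-GH-3.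
Unit `b2b-balaban-beta-d1-formalise-leaf-04` (gen 18), D1 formalisation swarm leaf prover 04, road «BF-x»; INTENT 1 «RK-GH-UNIT» FILE 4 (journal).
-/

noncomputable section

open Finset
open scoped BigOperators
open Literature.MathematicalPhysics.QuantumFieldTheory.Balaban1983to89
open Literature.MathematicalPhysics.QuantumFieldTheory.Balaban1983to89.Beta
open B12Sec2to5 (l1 l1_nonneg Decay510)
open B4Sect5Proof (latticeConst latticeConst_nonneg)
open B5Hk163Strip (kappa163 kappa163_pos)
open B5Hk163Decay (MG163)
open B4TorusKernel (periodConst)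
open ExpKernelCalculus (Site MKer Decays comp tr tadpole decay510_mono_const)
open KernelWard (Bdd)
open KernelSpecInstance (wH)
open Summit.QuantumFields.BalabanUV.Beta.TameKernelCalculus (decays_of_le)
open Summit.QuantumFields.BalabanUV.Beta.D1BFx.PackedKernelSplit (biBubble)
open Summit.QuantumFields.BalabanUV.Beta.D1BFx.RProjector (Pgt deltaPP deltaPP_pos)
open Summit.QuantumFields.BalabanUV.Beta.D1BFx.ProjectorSupNorm (cPPs cPPs_nonneg)
open Summit.QuantumFields.BalabanUV.Beta.D1BFx.GhostLeg (Ggh const_nonneg)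
open Summit.QuantumFields.BalabanUV.Beta.D1BFx.GhostLegFree (ghDelta ghDelta_pos)
open Summit.QuantumFields.BalabanUV.Beta.D1BFx.GhostLegBlockMass (cNear)
open Summit.QuantumFields.BalabanUV.Beta.D1BFx.RColumnBlockMass (cNear_nonneg)
open Summit.QuantumFields.BalabanUV.Beta.D1BFx.GhostStencil (ghCur)
open Summit.QuantumFields.BalabanUV.Beta.D1BFx.TorusGhostPairStencils (gh₂)
open Summit.QuantumFields.BalabanUV.Beta.D1BFx.ReducedKernelF (vertexRedF)
open Summit.QuantumFields.BalabanUV.Beta.D1BFx.ReducedTableF (tableRedF)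
open Summit.QuantumFields.BalabanUV.Beta.D1BFx.RestKernelGhostWords (GhIdx ghostWord ghostWordK pairLegL pairLegR)
open Summit.QuantumFields.BalabanUV.Beta.D1BFx.GhostWordFamilies (decay510_tadpoleWord_of_mass decay510_biBubbleWord_of_decays_bdd_mass
  decay510_biBubbleWord_of_bdd_decays_mass)
open Summit.QuantumFields.BalabanUV.Beta.D1BFx.GhostWordLegLetters (decays_of_le_const bdd_Pgt_sup decays_Ggh_PP bdd_comp_Pgt_Ggh bdd_comp_Ggh_Pgt bdd_comp_Ggh_Ggh
  bdd_comp_Ggh_Pgt_Ggh decays_comp_Pgt_Ggh decays_comp_Ggh_Pgt)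
open Summit.QuantumFields.BalabanUV.Beta.D1BFx.ProjectorSupNorm (decays_Pgt_sup)
open Summit.QuantumFields.BalabanUV.Beta.D1BFx.GhostWordJetLetters (mass_vertexRedF_ghCur_le mass_tableRedF_gh11_le')

namespace Summit.QuantumFields.BalabanUV.Beta.D1BFx.RestKernelGhostUnit

variable (m : ℕ) {a : ℝ}


/-! ## §1 Two scalar tools and the letters at the common rate -/

/-- [folklore] `Decay510` under the prefactor `½`. -/
theorem decay510_half_mul {f : Site 4 → ℝ} {C δ : ℝ} (h : Decay510 f C δ) : Decay510 (fun z => (1 / 2) * f z) ((1 / 2) * C) δ := fun z => by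
  rw [abs_mul, abs_of_pos (by norm_num : (0 : ℝ) < 1 / 2), mul_assoc]
  exact mul_le_mul_of_nonneg_left (h z) (by norm_num)

/-- [folklore] `Decay510` under the prefactor `−½`. -/
theorem decay510_neg_half_mul {f : Site 4 → ℝ} {C δ : ℝ} (h : Decay510 f C δ) : Decay510 (fun z => -(1 / 2) * f z) ((1 / 2) * C) δ := fun z => by
  rw [abs_mul, abs_neg, abs_of_pos (by norm_num : (0 : ℝ) < 1 / 2), mul_assoc]
  exact mul_le_mul_of_nonneg_left (h z) (by norm_num)

/-- [folklore] The common rate: `0 ≤ σn`, `σn ≤ κ′∕(16n)`, `σn ≤ δ_PP∕(8n) ≤ δ_PP∕(4n)`, `σn·n = σ₀`, `0 < σ₀`. -/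
theorem sigma_facts (ha : 0 < a) :
    0 ≤ (min (deltaPP 4 a / 8) (kappa163 (3 + 1) / (3 + 1) / 16) / ((m + 1 : ℕ) : ℝ)) ∧ (min (deltaPP 4 a / 8) (kappa163 (3 + 1) / (3 + 1) / 16) / ((m + 1 : ℕ) : ℝ)) ≤ kappa163 (3 + 1) / (3 + 1) / (16 * ((m + 1 : ℕ) : ℝ)) ∧ (min (deltaPP 4 a / 8) (kappa163 (3 + 1) / (3 + 1) / 16) / ((m + 1 : ℕ) : ℝ)) ≤ deltaPP 4 a / (8 * ((m + 1 : ℕ) : ℝ))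
      ∧ (min (deltaPP 4 a / 8) (kappa163 (3 + 1) / (3 + 1) / 16) / ((m + 1 : ℕ) : ℝ)) ≤ deltaPP 4 a / (4 * ((m + 1 : ℕ) : ℝ)) ∧ (min (deltaPP 4 a / 8) (kappa163 (3 + 1) / (3 + 1) / 16) / ((m + 1 : ℕ) : ℝ)) * ((m + 1 : ℕ) : ℝ) = min (deltaPP 4 a / 8) (kappa163 (3 + 1) / (3 + 1) / 16)
      ∧ 0 < min (deltaPP 4 a / 8) (kappa163 (3 + 1) / (3 + 1) / 16) := by
  have hn : (0 : ℝ) < ((m + 1 : ℕ) : ℝ) := by exact_mod_cast Nat.succ_pos m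
  have hδ := deltaPP_pos 4 ha
  have hκ : 0 < kappa163 (3 + 1) / (3 + 1) := by have := kappa163_pos (3 + 1); positivity
  have h0 : 0 < min (deltaPP 4 a / 8) (kappa163 (3 + 1) / (3 + 1) / 16) := lt_min (by positivity) (by positivity)
  have h1 : min (deltaPP 4 a / 8) (kappa163 (3 + 1) / (3 + 1) / 16) ≤ kappa163 (3 + 1) / (3 + 1) / 16 := min_le_right _ _
  have h2 : min (deltaPP 4 a / 8) (kappa163 (3 + 1) / (3 + 1) / 16) ≤ deltaPP 4 a / 8 := min_le_left _ _
  have h3 : min (deltaPP 4 a / 8) (kappa163 (3 + 1) / (3 + 1) / 16) ≤ deltaPP 4 a / 4 := h2.trans (by linarith)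
  refine ⟨by positivity, ?_, ?_, ?_, div_mul_cancel₀ _ hn.ne', h0⟩
  · rw [← div_div]; exact div_le_div_of_nonneg_right h1 hn.le
  · rw [← div_div]; exact div_le_div_of_nonneg_right h2 hn.le
  · rw [← div_div]; exact div_le_div_of_nonneg_right h3 hn.le

/-- [folklore] The ghost leg at the common rate: `Decays (Ggh n a) (2∕min 2 a) σn`. -/
theorem decays_Ggh_sigma (ha : 0 < a) : Decays (Ggh (m + 1) a) (2 / min 2 a) (min (deltaPP 4 a / 8) (kappa163 (3 + 1) / (3 + 1) / 16) / ((m + 1 : ℕ) : ℝ)) := by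
  have h := decays_of_le (decays_Ggh_PP (m + 1) ha) (sigma_facts m ha).2.2.2.1
  rwa [abs_of_nonneg (const_nonneg a ha)] at h

/-- [folklore] The projector at the common rate, sharp sup kept: `Decays (Pgt n a) (cPPs∕n⁴·e^{δ_PP}) σn`. -/
theorem decays_Pgt_sigma (ha : 0 < a) : Decays (Pgt (m + 1) a) (cPPs 4 a / ((m + 1 : ℕ) : ℝ) ^ 4 * Real.exp (deltaPP 4 a)) (min (deltaPP 4 a / 8) (kappa163 (3 + 1) / (3 + 1) / 16) / ((m + 1 : ℕ) : ℝ)) := by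
  have hn : (0 : ℝ) < ((m + 1 : ℕ) : ℝ) := by exact_mod_cast Nat.succ_pos m
  have h := decays_of_le (decays_Pgt_sup (m + 1) ha) (sigma_facts m ha).2.2.2.1
  rwa [abs_of_nonneg (by have := cPPs_nonneg 4 ha; positivity)] at h

/-- [folklore] The composites at the common rate (n-free constants of FILE 2 §5). -/
theorem decays_comp_Pgt_Ggh_sigma (ha : 0 < a) :
    Decays (comp (Pgt (m + 1) a) (Ggh (m + 1) a)) (cPPs 4 a * Real.exp (deltaPP 4 a) * (2 / min 2 a) * (1 + 16 / deltaPP 4 a) ^ 4) (min (deltaPP 4 a / 8) (kappa163 (3 + 1) / (3 + 1) / 16) / ((m + 1 : ℕ) : ℝ)) := by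
  have h := decays_of_le (decays_comp_Pgt_Ggh (m + 1) ha) (sigma_facts m ha).2.2.1
  rwa [abs_of_nonneg (by have := cPPs_nonneg 4 ha; have := const_nonneg a ha; have := deltaPP_pos 4 ha; positivity)] at h

/-- [folklore] `G∘P` at the common rate (n-free constant of FILE 2 §5). -/
theorem decays_comp_Ggh_Pgt_sigma (ha : 0 < a) :
    Decays (comp (Ggh (m + 1) a) (Pgt (m + 1) a)) ((2 / min 2 a) * (cPPs 4 a * Real.exp (deltaPP 4 a)) * (1 + 16 / deltaPP 4 a) ^ 4) (min (deltaPP 4 a / 8) (kappa163 (3 + 1) / (3 + 1) / 16) / ((m + 1 : ℕ) : ℝ)) := by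
  have h := decays_of_le (decays_comp_Ggh_Pgt (m + 1) ha) (sigma_facts m ha).2.2.1
  rwa [abs_of_nonneg (by have := cPPs_nonneg 4 ha; have := const_nonneg a ha; have := deltaPP_pos 4 ha; positivity)] at h

/-- [folklore] (1.22) from (5.10), the shape used below (`B12Sec2to5.secondMoment_abs_le_of_decay510`). -/
theorem abs_secondMoment_le {P : Fin 4 → Fin 4 → Site 4 → ℝ} {C δ : ℝ} {μ ν : Fin 4} (hδ : 0 < δ) (h : Decay510 (P μ ν) C δ) :
    |B12Beta.secondMoment P μ ν| ≤ C * ∑' x : Site 4, l1 x ^ 2 * Real.exp (-δ * l1 x) :=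
  (B12Sec2to5.secondMoment_abs_le_of_decay510 hδ h).2

/-- [folklore] The lattice moment sum is nonnegative. -/
theorem momentSum_nonneg (δ : ℝ) : 0 ≤ ∑' x : Site 4, l1 x ^ 2 * Real.exp (-δ * l1 x) :=
  tsum_nonneg fun _ => mul_nonneg (sq_nonneg _) (Real.exp_pos _).le

/-! ## §2 The twelve words as (5.10)-kernels with letter-product constants -/

section Words

variable (ha : 0 < a)
include ha

/-- [folklore] **TADPOLES** `i = inl b` (`½·tadpole (G∘P ∣ P∘G) (𝒲 μ 0 ν z)`): `Decay510 · (½·((cPPs∕n⁴)·MG)·mW) (κ′∕8)` — power `n⁻⁸`. -/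
theorem decay510_word_tadpole (b : Bool) (μ ν : Fin 4) :
    Decay510 (ghostWordK (Ggh (m + 1) a) (Pgt (m + 1) a) (fun κ u => (((m + 1 : ℕ) : ℝ) ^ 2) • vertexRedF (m + 1) (fun κ u => ghCur κ u) κ u)
          (fun κ u l u' => (((m + 1 : ℕ) : ℝ) ^ 2) • tableRedF (m + 1) (fun κ u l u' => if u = u' ∧ κ = l then gh₂ κ u else 0) κ u l u') (Sum.inl b) μ ν)
      ((1 / 2) * ((cPPs 4 a / ((m + 1 : ℕ) : ℝ) ^ 4 * (cNear a * latticeConst 4 (ghDelta a)))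
            * (32 * ((MG163 (3 + 1) * periodConst (kappa163 (3 + 1)) 3) * Real.exp (kappa163 (3 + 1) / (3 + 1))) ^ 2 * (1 + 16 / (kappa163 (3 + 1) / (3 + 1))) ^ 4 * ((((m + 1 : ℕ) : ℝ)) ^ 4)⁻¹))) (kappa163 (3 + 1) / (3 + 1) / 8) := by
  have hn : (0 : ℝ) < ((m + 1 : ℕ) : ℝ) := by exact_mod_cast Nat.succ_pos m
  have hS : 0 ≤ cPPs 4 a / ((m + 1 : ℕ) : ℝ) ^ 4 * (cNear a * latticeConst 4 (ghDelta a)) := by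
    have := cPPs_nonneg 4 ha; have := cNear_nonneg ha; have := latticeConst_nonneg 4 (ghDelta_pos ha).le; positivity
  have hWs := fun z : Site 4 => (mass_tableRedF_gh11_le' m μ 0 ν z).1
  have hWm : ∀ z : Site 4, _ ≤ (32 * ((MG163 (3 + 1) * periodConst (kappa163 (3 + 1)) 3) * Real.exp (kappa163 (3 + 1) / (3 + 1))) ^ 2 * (1 + 16 / (kappa163 (3 + 1) / (3 + 1))) ^ 4 * ((((m + 1 : ℕ) : ℝ)) ^ 4)⁻¹) * Real.exp (-(kappa163 (3 + 1) / (3 + 1) / 8) * l1 z) := fun z => by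
    simpa only [sub_zero] using (mass_tableRedF_gh11_le' m μ 0 ν z).2
  cases b
  · exact decay510_half_mul (decay510_tadpoleWord_of_mass (𝒲 := (fun κ u l u' => (((m + 1 : ℕ) : ℝ) ^ 2) • tableRedF (m + 1) (fun κ u l u' => if u = u' ∧ κ = l then gh₂ κ u else 0) κ u l u')) (bdd_comp_Pgt_Ggh (m + 1) ha) hS μ ν hWs hWm)
  · have hL : Bdd (comp (Ggh (m + 1) a) (Pgt (m + 1) a)) (cPPs 4 a / ((m + 1 : ℕ) : ℝ) ^ 4 * (cNear a * latticeConst 4 (ghDelta a))) :=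
      fun x y u v => (bdd_comp_Ggh_Pgt (m + 1) ha x y u v).trans (le_of_eq (mul_comm _ _))
    exact decay510_half_mul (decay510_tadpoleWord_of_mass (𝒲 := (fun κ u l u' => (((m + 1 : ℕ) : ℝ) ^ 2) • tableRedF (m + 1) (fun κ u l u' => if u = u' ∧ κ = l then gh₂ κ u else 0) κ u l u')) hL hS μ ν hWs hWm)

/-- [folklore] **SINGLE-`P` BUBBLES OVER `(G∘G, P)`** `i = inr (inl (none, s))`: decay on `P` (sharp `cPPs∕n⁴·e^{δ_PP}`), sup on `G∘G` (`SG·MG`):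
`Decay510 · (½·((SG·MG)·(cPPs∕n⁴·e^{δ_PP}))·mV·mV) σ₀` — power `n⁻⁴·n·n = n⁻²`. -/
theorem decay510_word_single_none (s : Bool) (μ ν : Fin 4) :
    Decay510 (ghostWordK (Ggh (m + 1) a) (Pgt (m + 1) a) (fun κ u => (((m + 1 : ℕ) : ℝ) ^ 2) • vertexRedF (m + 1) (fun κ u => ghCur κ u) κ u)
          (fun κ u l u' => (((m + 1 : ℕ) : ℝ) ^ 2) • tableRedF (m + 1) (fun κ u l u' => if u = u' ∧ κ = l then gh₂ κ u else 0) κ u l u') (Sum.inr (Sum.inl (none, s))) μ ν)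
      ((1 / 2) * ((2 / min 2 a * (cNear a * latticeConst 4 (ghDelta a))) * (cPPs 4 a / ((m + 1 : ℕ) : ℝ) ^ 4 * Real.exp (deltaPP 4 a))
            * (8 * Real.exp (kappa163 (3 + 1) / (3 + 1) / 16) * (MG163 (3 + 1) * periodConst (kappa163 (3 + 1)) 3) * Real.exp (kappa163 (3 + 1) / (3 + 1)) * (1 + 16 / (kappa163 (3 + 1) / (3 + 1))) ^ 4 * ((m + 1 : ℕ) : ℝ))
            * (8 * Real.exp (kappa163 (3 + 1) / (3 + 1) / 16) * (MG163 (3 + 1) * periodConst (kappa163 (3 + 1)) 3) * Real.exp (kappa163 (3 + 1) / (3 + 1)) * (1 + 16 / (kappa163 (3 + 1) / (3 + 1))) ^ 4 * ((m + 1 : ℕ) : ℝ))))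
      (min (deltaPP 4 a / 8) (kappa163 (3 + 1) / (3 + 1) / 16)) := by
  obtain ⟨hσ0, hσκ, -, -, hσN, -⟩ := sigma_facts m ha
  have hn : (0 : ℝ) < ((m + 1 : ℕ) : ℝ) := by exact_mod_cast Nat.succ_pos m
  have hSGG : 0 ≤ 2 / min 2 a * (cNear a * latticeConst 4 (ghDelta a)) := by
    have := const_nonneg a ha; have := cNear_nonneg ha; have := latticeConst_nonneg 4 (ghDelta_pos ha).le; positivity
  have hSP : 0 ≤ cPPs 4 a / ((m + 1 : ℕ) : ℝ) ^ 4 * Real.exp (deltaPP 4 a) := by have := cPPs_nonneg 4 ha; positivity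
  have hVs := fun y : Site 4 => (mass_vertexRedF_ghCur_le m hσ0 hσκ μ y).1
  have hVm := fun y : Site 4 => (mass_vertexRedF_ghCur_le m hσ0 hσκ μ y).2
  have hVs' := fun y : Site 4 => (mass_vertexRedF_ghCur_le m hσ0 hσκ ν y).1
  have hVm' := fun y : Site 4 => (mass_vertexRedF_ghCur_le m hσ0 hσκ ν y).2
  cases s
  · have h := decay510_biBubbleWord_of_bdd_decays_mass (𝒱 := (fun κ u => (((m + 1 : ℕ) : ℝ) ^ 2) • vertexRedF (m + 1) (fun κ u => ghCur κ u) κ u)) (𝒱' := (fun κ u => (((m + 1 : ℕ) : ℝ) ^ 2) • vertexRedF (m + 1) (fun κ u => ghCur κ u) κ u)) (bdd_comp_Ggh_Ggh (m + 1) ha) (decays_Pgt_sigma m ha) hσ0 hSGG hSP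
      μ ν hVs hVm hVs' hVm'
    rw [hσN] at h
    exact decay510_mono_const (decay510_neg_half_mul h) (le_of_eq (by ring))
  · have h := decay510_biBubbleWord_of_decays_bdd_mass (𝒱 := (fun κ u => (((m + 1 : ℕ) : ℝ) ^ 2) • vertexRedF (m + 1) (fun κ u => ghCur κ u) κ u)) (𝒱' := (fun κ u => (((m + 1 : ℕ) : ℝ) ^ 2) • vertexRedF (m + 1) (fun κ u => ghCur κ u) κ u)) (decays_Pgt_sigma m ha) (bdd_comp_Ggh_Ggh (m + 1) ha) hσ0 hSP hSGG
      μ ν hVs hVm hVs' hVm'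
    rw [hσN] at h
    exact decay510_mono_const (decay510_neg_half_mul h) (le_of_eq (by ring))

/-- [folklore] **SINGLE-`P` BUBBLES OVER `(G, P∘G)` AND `(G, G∘P)`** `i = inr (inl (some t, s))`: decay on `G` (`SG`), sup on the composite (`(cPPs∕n⁴)·MG`):
`Decay510 · (½·(SG·((cPPs∕n⁴)·MG))·mV·mV) σ₀` — power `n⁻²`. -/
theorem decay510_word_single_some (t s : Bool) (μ ν : Fin 4) :
    Decay510 (ghostWordK (Ggh (m + 1) a) (Pgt (m + 1) a) (fun κ u => (((m + 1 : ℕ) : ℝ) ^ 2) • vertexRedF (m + 1) (fun κ u => ghCur κ u) κ u)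
          (fun κ u l u' => (((m + 1 : ℕ) : ℝ) ^ 2) • tableRedF (m + 1) (fun κ u l u' => if u = u' ∧ κ = l then gh₂ κ u else 0) κ u l u') (Sum.inr (Sum.inl (some t, s))) μ ν)
      ((1 / 2) * ((2 / min 2 a) * (cPPs 4 a / ((m + 1 : ℕ) : ℝ) ^ 4 * (cNear a * latticeConst 4 (ghDelta a)))
            * (8 * Real.exp (kappa163 (3 + 1) / (3 + 1) / 16) * (MG163 (3 + 1) * periodConst (kappa163 (3 + 1)) 3) * Real.exp (kappa163 (3 + 1) / (3 + 1)) * (1 + 16 / (kappa163 (3 + 1) / (3 + 1))) ^ 4 * ((m + 1 : ℕ) : ℝ))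
            * (8 * Real.exp (kappa163 (3 + 1) / (3 + 1) / 16) * (MG163 (3 + 1) * periodConst (kappa163 (3 + 1)) 3) * Real.exp (kappa163 (3 + 1) / (3 + 1)) * (1 + 16 / (kappa163 (3 + 1) / (3 + 1))) ^ 4 * ((m + 1 : ℕ) : ℝ))))
      (min (deltaPP 4 a / 8) (kappa163 (3 + 1) / (3 + 1) / 16)) := by
  obtain ⟨hσ0, hσκ, -, -, hσN, -⟩ := sigma_facts m ha
  have hn : (0 : ℝ) < ((m + 1 : ℕ) : ℝ) := by exact_mod_cast Nat.succ_pos m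
  have hSG : 0 ≤ 2 / min 2 a := const_nonneg a ha
  have hB : 0 ≤ cPPs 4 a / ((m + 1 : ℕ) : ℝ) ^ 4 * (cNear a * latticeConst 4 (ghDelta a)) := by
    have := cPPs_nonneg 4 ha; have := cNear_nonneg ha; have := latticeConst_nonneg 4 (ghDelta_pos ha).le; positivity
  have hB' : 0 ≤ (cNear a * latticeConst 4 (ghDelta a)) * (cPPs 4 a / ((m + 1 : ℕ) : ℝ) ^ 4) := by rw [mul_comm]; exact hB
  have hVs := fun y : Site 4 => (mass_vertexRedF_ghCur_le m hσ0 hσκ μ y).1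
  have hVm := fun y : Site 4 => (mass_vertexRedF_ghCur_le m hσ0 hσκ μ y).2
  have hVs' := fun y : Site 4 => (mass_vertexRedF_ghCur_le m hσ0 hσκ ν y).1
  have hVm' := fun y : Site 4 => (mass_vertexRedF_ghCur_le m hσ0 hσκ ν y).2
  cases t <;> cases s
  · -- `(G, P∘G)`, order `s = false`: `biBubble G V (P∘G) V′`
    have h := decay510_biBubbleWord_of_decays_bdd_mass (𝒱 := (fun κ u => (((m + 1 : ℕ) : ℝ) ^ 2) • vertexRedF (m + 1) (fun κ u => ghCur κ u) κ u)) (𝒱' := (fun κ u => (((m + 1 : ℕ) : ℝ) ^ 2) • vertexRedF (m + 1) (fun κ u => ghCur κ u) κ u)) (decays_Ggh_sigma m ha) (bdd_comp_Pgt_Ggh (m + 1) ha) hσ0 hSG hB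
      μ ν hVs hVm hVs' hVm'
    rw [hσN] at h
    exact decay510_mono_const (decay510_neg_half_mul h) (le_of_eq (by ring))
  · -- `(G, P∘G)`, order `s = true`: `biBubble (P∘G) V G V′`
    have h := decay510_biBubbleWord_of_bdd_decays_mass (𝒱 := (fun κ u => (((m + 1 : ℕ) : ℝ) ^ 2) • vertexRedF (m + 1) (fun κ u => ghCur κ u) κ u)) (𝒱' := (fun κ u => (((m + 1 : ℕ) : ℝ) ^ 2) • vertexRedF (m + 1) (fun κ u => ghCur κ u) κ u)) (bdd_comp_Pgt_Ggh (m + 1) ha) (decays_Ggh_sigma m ha) hσ0 hB hSG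
      μ ν hVs hVm hVs' hVm'
    rw [hσN] at h
    exact decay510_mono_const (decay510_neg_half_mul h) (le_of_eq (by ring))
  · -- `(G, G∘P)`, order `s = false`
    have h := decay510_biBubbleWord_of_decays_bdd_mass (𝒱 := (fun κ u => (((m + 1 : ℕ) : ℝ) ^ 2) • vertexRedF (m + 1) (fun κ u => ghCur κ u) κ u)) (𝒱' := (fun κ u => (((m + 1 : ℕ) : ℝ) ^ 2) • vertexRedF (m + 1) (fun κ u => ghCur κ u) κ u)) (decays_Ggh_sigma m ha) (bdd_comp_Ggh_Pgt (m + 1) ha) hσ0 hSG hB'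
      μ ν hVs hVm hVs' hVm'
    rw [hσN] at h
    exact decay510_mono_const (decay510_neg_half_mul h) (le_of_eq (by ring))
  · -- `(G, G∘P)`, order `s = true`
    have h := decay510_biBubbleWord_of_bdd_decays_mass (𝒱 := (fun κ u => (((m + 1 : ℕ) : ℝ) ^ 2) • vertexRedF (m + 1) (fun κ u => ghCur κ u) κ u)) (𝒱' := (fun κ u => (((m + 1 : ℕ) : ℝ) ^ 2) • vertexRedF (m + 1) (fun κ u => ghCur κ u) κ u)) (bdd_comp_Ggh_Pgt (m + 1) ha) (decays_Ggh_sigma m ha) hσ0 hB' hSG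
      μ ν hVs hVm hVs' hVm'
    rw [hσN] at h
    exact decay510_mono_const (decay510_neg_half_mul h) (le_of_eq (by ring))

/-- [folklore] **SELF DOUBLE-`P` BUBBLES** `i = inr (inr (inl b))` (`(G∘P, G∘P)` ∣ `(P∘G, P∘G)`): decay on one copy (n-free `KPG`), sup on the other (`(cPPs∕n⁴)·MG`):
`Decay510 · (½·(KPG·((cPPs∕n⁴)·MG))·mV·mV) σ₀` — power `n⁻²`. -/
theorem decay510_word_double_self (b : Bool) (μ ν : Fin 4) :
    Decay510 (ghostWordK (Ggh (m + 1) a) (Pgt (m + 1) a) (fun κ u => (((m + 1 : ℕ) : ℝ) ^ 2) • vertexRedF (m + 1) (fun κ u => ghCur κ u) κ u)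
          (fun κ u l u' => (((m + 1 : ℕ) : ℝ) ^ 2) • tableRedF (m + 1) (fun κ u l u' => if u = u' ∧ κ = l then gh₂ κ u else 0) κ u l u') (Sum.inr (Sum.inr (Sum.inl b))) μ ν)
      ((1 / 2) * ((cPPs 4 a * Real.exp (deltaPP 4 a) * (2 / min 2 a) * (1 + 16 / deltaPP 4 a) ^ 4)
        * (cPPs 4 a / ((m + 1 : ℕ) : ℝ) ^ 4 * (cNear a * latticeConst 4 (ghDelta a))) * (8 * Real.exp (kappa163 (3 + 1) / (3 + 1) / 16) * (MG163 (3 + 1) * periodConst (kappa163 (3 + 1)) 3) * Real.exp (kappa163 (3 + 1) / (3 + 1)) * (1 + 16 / (kappa163 (3 + 1) / (3 + 1))) ^ 4 * ((m + 1 : ℕ) : ℝ)) * (8 * Real.exp (kappa163 (3 + 1) / (3 + 1) / 16) * (MG163 (3 + 1) * periodConst (kappa163 (3 + 1)) 3) * Real.exp (kappa163 (3 + 1) / (3 + 1)) * (1 + 16 / (kappa163 (3 + 1) / (3 + 1))) ^ 4 * ((m + 1 : ℕ) : ℝ))))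
      (min (deltaPP 4 a / 8) (kappa163 (3 + 1) / (3 + 1) / 16)) := by
  obtain ⟨hσ0, hσκ, -, -, hσN, -⟩ := sigma_facts m ha
  have hn : (0 : ℝ) < ((m + 1 : ℕ) : ℝ) := by exact_mod_cast Nat.succ_pos m
  have hK : 0 ≤ cPPs 4 a * Real.exp (deltaPP 4 a) * (2 / min 2 a) * (1 + 16 / deltaPP 4 a) ^ 4 := by
    have := cPPs_nonneg 4 ha; have := const_nonneg a ha; have := deltaPP_pos 4 ha; positivity
  have hK' : 0 ≤ (2 / min 2 a) * (cPPs 4 a * Real.exp (deltaPP 4 a)) * (1 + 16 / deltaPP 4 a) ^ 4 := by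
    have := cPPs_nonneg 4 ha; have := const_nonneg a ha; have := deltaPP_pos 4 ha; positivity
  have hB : 0 ≤ cPPs 4 a / ((m + 1 : ℕ) : ℝ) ^ 4 * (cNear a * latticeConst 4 (ghDelta a)) := by
    have := cPPs_nonneg 4 ha; have := cNear_nonneg ha; have := latticeConst_nonneg 4 (ghDelta_pos ha).le; positivity
  have hB' : 0 ≤ (cNear a * latticeConst 4 (ghDelta a)) * (cPPs 4 a / ((m + 1 : ℕ) : ℝ) ^ 4) := by rw [mul_comm]; exact hB
  have hVs := fun y : Site 4 => (mass_vertexRedF_ghCur_le m hσ0 hσκ μ y).1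
  have hVm := fun y : Site 4 => (mass_vertexRedF_ghCur_le m hσ0 hσκ μ y).2
  have hVs' := fun y : Site 4 => (mass_vertexRedF_ghCur_le m hσ0 hσκ ν y).1
  have hVm' := fun y : Site 4 => (mass_vertexRedF_ghCur_le m hσ0 hσκ ν y).2
  cases b
  · -- `(P∘G, P∘G)`
    have h := decay510_biBubbleWord_of_decays_bdd_mass (𝒱 := (fun κ u => (((m + 1 : ℕ) : ℝ) ^ 2) • vertexRedF (m + 1) (fun κ u => ghCur κ u) κ u)) (𝒱' := (fun κ u => (((m + 1 : ℕ) : ℝ) ^ 2) • vertexRedF (m + 1) (fun κ u => ghCur κ u) κ u)) (decays_comp_Pgt_Ggh_sigma m ha) (bdd_comp_Pgt_Ggh (m + 1) ha)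
      hσ0 hK hB μ ν hVs hVm hVs' hVm'
    rw [hσN] at h
    exact decay510_mono_const (decay510_half_mul h) (le_of_eq (by ring))
  · -- `(G∘P, G∘P)`
    have h := decay510_biBubbleWord_of_decays_bdd_mass (𝒱 := (fun κ u => (((m + 1 : ℕ) : ℝ) ^ 2) • vertexRedF (m + 1) (fun κ u => ghCur κ u) κ u)) (𝒱' := (fun κ u => (((m + 1 : ℕ) : ℝ) ^ 2) • vertexRedF (m + 1) (fun κ u => ghCur κ u) κ u)) (decays_comp_Ggh_Pgt_sigma m ha) (bdd_comp_Ggh_Pgt (m + 1) ha)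
      hσ0 hK' hB' μ ν hVs hVm hVs' hVm'
    rw [hσN] at h
    exact decay510_mono_const (decay510_half_mul h) (le_of_eq (by ring))

/-- [folklore] **MIXED DOUBLE-`P` BUBBLES** `i = inr (inr (inr b))` (`(P, G∘P∘G)` ∣ `(G∘P∘G, P)`): decay on `P` (`cPPs∕n⁴·e^{δ_PP}`), sup on `G∘P∘G` (`MG·((cPPs∕n⁴)·MG)`):
`Decay510 · (½·((cPPs∕n⁴·e^{δ_PP})·(MG·((cPPs∕n⁴)·MG)))·mV·mV) σ₀` — power `n⁻⁶`. -/
theorem decay510_word_double_mixed (b : Bool) (μ ν : Fin 4) :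
    Decay510 (ghostWordK (Ggh (m + 1) a) (Pgt (m + 1) a) (fun κ u => (((m + 1 : ℕ) : ℝ) ^ 2) • vertexRedF (m + 1) (fun κ u => ghCur κ u) κ u)
          (fun κ u l u' => (((m + 1 : ℕ) : ℝ) ^ 2) • tableRedF (m + 1) (fun κ u l u' => if u = u' ∧ κ = l then gh₂ κ u else 0) κ u l u') (Sum.inr (Sum.inr (Sum.inr b))) μ ν)
      ((1 / 2) * ((cPPs 4 a / ((m + 1 : ℕ) : ℝ) ^ 4 * Real.exp (deltaPP 4 a))
        * ((cNear a * latticeConst 4 (ghDelta a)) * (cPPs 4 a / ((m + 1 : ℕ) : ℝ) ^ 4 * (cNear a * latticeConst 4 (ghDelta a)))) * (8 * Real.exp (kappa163 (3 + 1) / (3 + 1) / 16) * (MG163 (3 + 1) * periodConst (kappa163 (3 + 1)) 3) * Real.exp (kappa163 (3 + 1) / (3 + 1)) * (1 + 16 / (kappa163 (3 + 1) / (3 + 1))) ^ 4 * ((m + 1 : ℕ) : ℝ)) * (8 * Real.exp (kappa163 (3 + 1) / (3 + 1) / 16) * (MG163 (3 + 1) * periodConst (kappa163 (3 + 1)) 3)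 * Real.exp (kappa163 (3 + 1) / (3 + 1)) * (1 + 16 / (kappa163 (3 + 1) / (3 + 1))) ^ 4 * ((m + 1 : ℕ) : ℝ))))
      (min (deltaPP 4 a / 8) (kappa163 (3 + 1) / (3 + 1) / 16)) := by
  obtain ⟨hσ0, hσκ, -, -, hσN, -⟩ := sigma_facts m ha
  have hn : (0 : ℝ) < ((m + 1 : ℕ) : ℝ) := by exact_mod_cast Nat.succ_pos m
  have hSP : 0 ≤ cPPs 4 a / ((m + 1 : ℕ) : ℝ) ^ 4 * Real.exp (deltaPP 4 a) := by have := cPPs_nonneg 4 ha; positivity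
  have hB : 0 ≤ (cNear a * latticeConst 4 (ghDelta a)) * (cPPs 4 a / ((m + 1 : ℕ) : ℝ) ^ 4 * (cNear a * latticeConst 4 (ghDelta a))) := by
    have := cPPs_nonneg 4 ha; have := cNear_nonneg ha; have := latticeConst_nonneg 4 (ghDelta_pos ha).le; positivity
  have hVs := fun y : Site 4 => (mass_vertexRedF_ghCur_le m hσ0 hσκ μ y).1
  have hVm := fun y : Site 4 => (mass_vertexRedF_ghCur_le m hσ0 hσκ μ y).2
  have hVs' := fun y : Site 4 => (mass_vertexRedF_ghCur_le m hσ0 hσκ ν y).1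
  have hVm' := fun y : Site 4 => (mass_vertexRedF_ghCur_le m hσ0 hσκ ν y).2
  cases b
  · -- `(G∘P∘G, P)`: `biBubble (G∘(P∘G)) V P V′`
    have h := decay510_biBubbleWord_of_bdd_decays_mass (𝒱 := (fun κ u => (((m + 1 : ℕ) : ℝ) ^ 2) • vertexRedF (m + 1) (fun κ u => ghCur κ u) κ u)) (𝒱' := (fun κ u => (((m + 1 : ℕ) : ℝ) ^ 2) • vertexRedF (m + 1) (fun κ u => ghCur κ u) κ u)) (bdd_comp_Ggh_Pgt_Ggh (m + 1) ha) (decays_Pgt_sigma m ha) hσ0 hB hSP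
      μ ν hVs hVm hVs' hVm'
    rw [hσN] at h
    exact decay510_mono_const (decay510_half_mul h) (le_of_eq (by ring))
  · -- `(P, G∘P∘G)`: `biBubble P V (G∘(P∘G)) V′`
    have h := decay510_biBubbleWord_of_decays_bdd_mass (𝒱 := (fun κ u => (((m + 1 : ℕ) : ℝ) ^ 2) • vertexRedF (m + 1) (fun κ u => ghCur κ u) κ u)) (𝒱' := (fun κ u => (((m + 1 : ℕ) : ℝ) ^ 2) • vertexRedF (m + 1) (fun κ u => ghCur κ u) κ u)) (decays_Pgt_sigma m ha) (bdd_comp_Ggh_Pgt_Ggh (m + 1) ha) hσ0 hSP hB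
      μ ν hVs hVm hVs' hVm'
    rw [hσN] at h
    exact decay510_mono_const (decay510_half_mul h) (le_of_eq (by ring))

end Words

end Summit.QuantumFields.BalabanUV.Beta.D1BFx.RestKernelGhostUnit

end
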